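import Mathlib
import HarnessLib
import Summits.Ventures.LatticeQCDFlow.Exactness.DoeblinObservables
import Summits.Ventures.LatticeQCDFlow.Exactness.MetropolisSweepConvergence

/-!
# Setwise-close Markov kernels stay close under composition: the error of an approximate update accumulates at most additively along a run

HONEST FRAMING: exact (Metropolis-corrected) sampling algorithms for lattice gauge theory;
figures of merit are autocorrelation/cost numbers at stated couplings and volumes; no
continuum-physics claim.

Venture `LatticeQCDFlow` (cell pub-lqcd), topic `Exactness`, FANOUT row 9 (eng-latcore).  NEW WORK of the
cell over the tree (`DoeblinObservables.abs_integral_sub_integral_le_of_setwise`: a setwise bound controls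
every `[0,1]`-valued observable; `InvariantComposition.nHit`) and Mathlib; nothing is cited as a fact; no
number is claimed.  Companion of `RejectionSamplingCap.lean` / `RejectionSamplingCapMixture.lean`: there a rejection loop
capped at `c` rounds is shown to be within `rᶜ` of the exact draw in total variation; this file is the bookkeeping that
carries such a per-update bound through a sweep and a run.

Setwise closeness "`|κ(x, A) − κ'(x, A)| ≤ δ` for every state `x` and every measurable `A`" is written out in
every statement (no predicate is introduced).
* `comp_real_apply` — `(η ∘ₖ κ)(x, A) = ∫ η(y, A) κ(x, dy)` in real numbers.
* **`tvClose_comp`** — `κ, κ'` setwise `δ₁`-close and `η, η'` setwise `δ₂`-close (Markov) ⇒ `η ∘ₖ κ` and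
  `η' ∘ₖ κ'` setwise `(δ₁ + δ₂)`-close: errors ADD along a composition.
* **`tvClose_nHit`** — setwise `δ`-close ⇒ the `t`-th powers are setwise `t·δ`-close, every `t`.
* **`tvClose_bind`** — from any initial probability law `μ`: `|μκᵗ(A) − μκ'ᵗ(A)| ≤ t·δ`.
* **`abs_invariant_sub_invariant_le`** — BIAS AT EQUILIBRIUM: if `κ` is Doeblin (`ε•ν ≤ κ(x,·)`) with invariant
  probability law `π` and `κ'` is setwise `δ`-close with ANY invariant probability law `π'`, then
  `|π'(A) − π(A)| ≤ t·δ + (1 − ε)ᵗ` for every `t` (the tree's `uniformlyErgodic_of_minorised` + `tvClose_bind`).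
* `tvClose_of_map` — deterministic post-processing does not increase the distance: if
  `κ(x, ·) = ν(x, ·) ∘ Φₓ⁻¹` and `κ'(x, ·) = ν'(x, ·) ∘ Φₓ⁻¹` with `ν, ν'` setwise `δ`-close, so are `κ, κ'`
  (a link update is a measurable function of the configuration and the inner draw).

Reading for the engine (value-free): if ONE link update as coded is within `δ` of the exact heat-bath hit
uniformly in the configuration (capped inner draw: `δ = rᶜ`, `RejectionSamplingCapMixture.lean`), then a sweep of
`m` hits is within `m·δ` of the exact sweep and `t` sweeps within `t·m·δ`, from every initial law, in
total variation; and any stationary law of the sweep as coded is within `inf_t (t·m·δ + (1 − ε)ᵗ)` of the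
exact Gibbs law whenever the exact sweep is Doeblin with constant `ε` (the tree's heat-bath sweeps are).  NOT CLAIMED: any value of `δ` for the engine's proposals; anything about floating point.
-/

noncomputable section

namespace Summit.Ventures.LatticeQCDFlow.Exactness

open MeasureTheory ProbabilityTheory ProbabilityTheory.Kernel Set
open scoped ENNReal

variable {Ω : Type*} [MeasurableSpace Ω]

/-! Setwise closeness of two kernels, uniformly in the state, is written out as
`∀ x A, MeasurableSet A → |κ(x, A) − κ'(x, A)| ≤ δ` throughout (no predicate is introduced). -/

section Comp

variable {κ κ' η η' : Kernel Ω Ω} [IsMarkovKernel κ] [IsMarkovKernel κ'] [IsMarkovKernel η] [IsMarkovKernel η']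
  {δ δ₁ δ₂ : ℝ}

/-- The composite evaluated on a set, in real numbers: `(η ∘ₖ κ)(x, A) = ∫ η(y, A) κ(x, dy)`. -/
theorem comp_real_apply (η κ : Kernel Ω Ω) [IsMarkovKernel η] (x : Ω) {A : Set Ω} (hA : MeasurableSet A) :
    ((η ∘ₖ κ) x).real A = ∫ y, (η y).real A ∂(κ x) := by
  rw [measureReal_def, Kernel.comp_apply' _ _ _ hA]
  simp_rw [measureReal_def]
  exact (integral_toReal ((Kernel.measurable_coe η hA).aemeasurable) (ae_of_all _ fun y => measure_lt_top _ _)).symm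

/-- **ERRORS ADD ALONG A COMPOSITION**: if `κ, κ'` are setwise `δ₁`-close and `η, η'` setwise `δ₂`-close
(all Markov), then `η ∘ₖ κ` and `η' ∘ₖ κ'` are setwise `(δ₁ + δ₂)`-close. -/
theorem tvClose_comp (hκ : ∀ (x : Ω) (A : Set Ω), MeasurableSet A → |(κ x).real A - (κ' x).real A| ≤ δ₁)
    (hη : ∀ (x : Ω) (A : Set Ω), MeasurableSet A → |(η x).real A - (η' x).real A| ≤ δ₂) :
    ∀ (x : Ω) (A : Set Ω), MeasurableSet A → |((η ∘ₖ κ) x).real A - ((η' ∘ₖ κ') x).real A| ≤ δ₁ + δ₂ := by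
  intro x A hA
  rw [comp_real_apply η κ x hA, comp_real_apply η' κ' x hA]
  have hg : Measurable fun y => (η y).real A := (Kernel.measurable_coe η hA).ennreal_toReal
  have hg' : Measurable fun y => (η' y).real A := (Kernel.measurable_coe η' hA).ennreal_toReal
  -- change the driving kernel: a setwise bound controls the `[0,1]`-valued observable `y ↦ η(y, A)`
  have h1 : |∫ y, (η y).real A ∂(κ x) - ∫ y, (η y).real A ∂(κ' x)| ≤ δ₁ :=
    abs_integral_sub_integral_le_of_setwise (fun B hB => hκ x B hB) hg (fun y => measureReal_nonneg)
      (fun y => measureReal_le_one)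
  -- change the integrand: pointwise within `δ₂`
  have hint : ∀ (f : Ω → ℝ), Measurable f → (∀ y, |f y| ≤ 1) → Integrable f (κ' x) := fun f hf hb =>
    (integrable_const (1 : ℝ)).mono' hf.aestronglyMeasurable (ae_of_all _ fun y => by
      rw [Real.norm_eq_abs]; exact hb y)
  have h2 : |∫ y, (η y).real A ∂(κ' x) - ∫ y, (η' y).real A ∂(κ' x)| ≤ δ₂ := by
    rw [← integral_sub (hint _ hg fun y => by rw [abs_of_nonneg measureReal_nonneg]; exact measureReal_le_one)
      (hint _ hg' fun y => by rw [abs_of_nonneg measureReal_nonneg]; exact measureReal_le_one), ← Real.norm_eq_abs]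
    calc ‖∫ y, ((η y).real A - (η' y).real A) ∂(κ' x)‖ ≤ δ₂ * (κ' x).real univ :=
          norm_integral_le_of_norm_le_const (ae_of_all _ fun y => by rw [Real.norm_eq_abs]; exact hη y A hA)
      _ = δ₂ := by rw [probReal_univ, mul_one]
  calc |∫ y, (η y).real A ∂(κ x) - ∫ y, (η' y).real A ∂(κ' x)|
      = |(∫ y, (η y).real A ∂(κ x) - ∫ y, (η y).real A ∂(κ' x)) +
          (∫ y, (η y).real A ∂(κ' x) - ∫ y, (η' y).real A ∂(κ' x))| := by ring_nf
    _ ≤ δ₁ + δ₂ := (abs_add_le _ _).trans (add_le_add h1 h2)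

/-- **THE ERROR OF AN APPROXIMATE UPDATE ACCUMULATES AT MOST ADDITIVELY**: setwise `δ`-close Markov kernels
have setwise `t·δ`-close `t`-th powers. -/
theorem tvClose_nHit (h : ∀ (x : Ω) (A : Set Ω), MeasurableSet A → |(κ x).real A - (κ' x).real A| ≤ δ) :
    ∀ t : ℕ, ∀ (x : Ω) (A : Set Ω), MeasurableSet A → |(nHit κ t x).real A - (nHit κ' t x).real A| ≤ t * δ
  | 0 => by
      intro x A hA
      rw [nHit_zero, nHit_zero, sub_self, abs_zero, Nat.cast_zero, zero_mul]
  | t + 1 => by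
      haveI : IsMarkovKernel (nHit κ t) := isMarkovKernel_nHit _ _
      haveI : IsMarkovKernel (nHit κ' t) := isMarkovKernel_nHit _ _
      have hrec := tvClose_nHit h t
      rw [nHit_succ, nHit_succ, Nat.cast_succ, add_mul, one_mul]
      exact tvClose_comp hrec h

/-- **… from any initial probability law**: `|μκᵗ(A) − μκ'ᵗ(A)| ≤ t·δ`. -/
theorem tvClose_bind (h : ∀ (x : Ω) (A : Set Ω), MeasurableSet A → |(κ x).real A - (κ' x).real A| ≤ δ)
    (μ : Measure Ω) [IsProbabilityMeasure μ] (t : ℕ) {A : Set Ω}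
    (hA : MeasurableSet A) :
    |(μ.bind (nHit κ t)).real A - (μ.bind (nHit κ' t)).real A| ≤ t * δ := by
  haveI : IsMarkovKernel (nHit κ t) := isMarkovKernel_nHit _ _
  haveI : IsMarkovKernel (nHit κ' t) := isMarkovKernel_nHit _ _
  have hreal : ∀ (ξ : Kernel Ω Ω) [IsMarkovKernel ξ], (μ.bind ξ).real A = ∫ y, (ξ y).real A ∂μ := fun ξ _ => by
    rw [measureReal_def, Measure.bind_apply hA (Kernel.aemeasurable ξ)]
    simp_rw [measureReal_def]
    exact (integral_toReal ((Kernel.measurable_coe ξ hA).aemeasurable) (ae_of_all _ fun y => measure_lt_top _ _)).symm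
  have hint : ∀ (ξ : Kernel Ω Ω) [IsMarkovKernel ξ], Integrable (fun y => (ξ y).real A) μ := fun ξ _ =>
    (integrable_const (1 : ℝ)).mono' ((Kernel.measurable_coe ξ hA).ennreal_toReal.aestronglyMeasurable)
      (ae_of_all _ fun y => by
        rw [Real.norm_eq_abs, abs_of_nonneg measureReal_nonneg]; exact measureReal_le_one)
  rw [hreal, hreal, ← integral_sub (hint _) (hint _), ← Real.norm_eq_abs]
  calc ‖∫ y, ((nHit κ t y).real A - (nHit κ' t y).real A) ∂μ‖ ≤ (t * δ) * μ.real univ :=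
        norm_integral_le_of_norm_le_const (ae_of_all _ fun y => by
          rw [Real.norm_eq_abs]; exact tvClose_nHit h t y A hA)
    _ = t * δ := by rw [probReal_univ, mul_one]

end Comp

/-! ## The stationary law of an approximate update is close to the exact one -/

section Stationary

variable {κ κ' : Kernel Ω Ω} [IsMarkovKernel κ] [IsMarkovKernel κ'] {δ : ℝ}

/-- **BIAS AT EQUILIBRIUM**: `κ` Markov with a Doeblin minorant `ε • ν ≤ κ(x, ·)` and invariant probability law
`π`; `κ'` Markov, setwise `δ`-close to `κ` uniformly in the state, with ANY invariant probability law `π'`.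
Then for every `t` and every measurable `A`: `|π'(A) − π(A)| ≤ t·δ + (1 − ε)ᵗ` — the law an approximate
update actually samples is within `inf_t (t·δ + (1 − ε)ᵗ)` of the exact target. -/
theorem abs_invariant_sub_invariant_le
    (h : ∀ (x : Ω) (A : Set Ω), MeasurableSet A → |(κ x).real A - (κ' x).real A| ≤ δ)
    {ν : Measure Ω} [IsProbabilityMeasure ν] {ε : ℝ≥0∞} (hmin : ∀ x, ε • ν ≤ κ x)
    {π π' : Measure Ω} [IsProbabilityMeasure π] [IsProbabilityMeasure π'] (hπ : Invariant κ π)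
    (hπ' : Invariant κ' π') (t : ℕ) {A : Set Ω} (hA : MeasurableSet A) :
    |π'.real A - π.real A| ≤ t * δ + (1 - ε.toReal) ^ t := by
  have hfix : π'.bind (nHit κ' t) = π' := (invariant_nHit hπ' t).def
  have h1 := tvClose_bind h π' t hA
  rw [hfix] at h1
  have h2 := uniformlyErgodic_of_minorised hmin hπ π' t A
  rw [← bind_nHit (κ := κ) π' t] at h2
  calc |π'.real A - π.real A|
      ≤ |π'.real A - (π'.bind (nHit κ t)).real A| + |(π'.bind (nHit κ t)).real A - π.real A| := abs_sub_le _ _ _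
    _ ≤ t * δ + (1 - ε.toReal) ^ t := add_le_add (by rw [abs_sub_comm]; exact h1) h2

end Stationary

section Map

variable {D : Type*} [MeasurableSpace D]

/-- **DETERMINISTIC POST-PROCESSING DOES NOT INCREASE THE DISTANCE**: if the update is a measurable
function `Φₓ` of the state and of an inner draw whose laws `ν(x, ·)`, `ν'(x, ·)` are setwise `δ`-close
for every `x`, the resulting kernels are setwise `δ`-close. -/
theorem tvClose_of_map {κ κ' : Kernel Ω Ω} {ν ν' : Ω → Measure D} {Φ : Ω → D → Ω} {δ : ℝ}
    (hΦ : ∀ x, Measurable (Φ x)) (hν : ∀ (x : Ω) (B : Set D), MeasurableSet B → |(ν x).real B - (ν' x).real B| ≤ δ)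
    (hκ : ∀ x, κ x = (ν x).map (Φ x)) (hκ' : ∀ x, κ' x = (ν' x).map (Φ x)) :
    ∀ (x : Ω) (A : Set Ω), MeasurableSet A → |(κ x).real A - (κ' x).real A| ≤ δ := by
  intro x A hA
  rw [hκ x, hκ' x, measureReal_def, measureReal_def, Measure.map_apply (hΦ x) hA, Measure.map_apply (hΦ x) hA,
    ← measureReal_def, ← measureReal_def]
  exact hν x _ (hΦ x hA)

end Map

end Summit.Ventures.LatticeQCDFlow.Exactness
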